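import Mathlib.LinearAlgebra.BilinearForm.Orthogonal
import Literature.Geometry.Riemannian.SectionalPinchingEstimate
import Literature.Geometry.Riemannian.ConstantCurvature
import Literature.Geometry.Riemannian.RicciFlowScalarCurvatureProofs
import HarnessLib

/-!
# Einstein three-manifolds have constant sectional curvature (proved)

Topic `Literature/Geometry/Riemannian`. The three-dimensional companion of
`EinsteinWeylZero.lean` (dimension `4`, under `W = 0`): in dimension `3` the Ricci tensor
determines the sectional curvatures — for a `g_x`-orthonormal basis `(b₀, b₁, b₂)`,
`Ric(b₀,b₀) = K₀₁ + K₀₂`, `Ric(b₁,b₁) = K₀₁ + K₁₂`, `Ric(b₂,b₂) = K₀₂ + K₁₂` (Lee 2018, Prop. 8.32 (a)),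
whence `2 K₀₁ = Ric(b₀,b₀) + Ric(b₁,b₁) - Ric(b₂,b₂)` — so an Einstein metric `Ric = λ g` on a
`3`-manifold has constant sectional curvature `λ/2` (Lee 2018, Problem 8-14; the last step of the
classification of compact three-dimensional shrinking Ricci solitons, Ivey 1993 /
Eminenti–La Nave–Mantegazza 2008: "Einstein, hence constant curvature since `n = 3`").
Everything here is PROVED over the tree's vocabulary; no definitions, no named facts:

* `exists_basis_fin_three_extends` — a `g_x`-orthonormal pair `X, Y` in a `3`-dimensional
  positive definite `T_x M` extends to a `g_x`-orthonormal basis `(X, Y, Z)` (rank–nullity for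
  `v ↦ (g(X,v), g(Y,v))`, normalisation, `basisOfLinearIndependentOfCardEqFinrank`);
* `two_mul_curvatureForm_pair_eq_of_fin_three` — `2 Rm(b₀,b₁,b₁,b₀) = Ric(b₀,b₀) + Ric(b₁,b₁) -
  Ric(b₂,b₂)` for any Levi-Civita connection of `g` and any `g_x`-orthonormal basis `b` of a
  `3`-dimensional tangent space (`ricci_eq_sum_of_isOrthonormalFrame` and pair symmetry);
* `curvatureForm_pair_eq_of_ricci_eq_three` — `Ric_x = λ g_x` gives `Rm(X,Y,Y,X) = λ/2` on every
  `g_x`-orthonormal pair;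
* `hasConstantSectionalCurvatureWith_of_ricci_eq_three` — `Ric = λ g` on a Riemannian manifold
  modelled on a `3`-dimensional space gives
  `Rm(X,Y,Z,W) = (λ/2)(g(Y,Z) g(X,W) - g(X,Z) g(Y,W))` for `g.leviCivita`
  (`HasConstantSectionalCurvatureWith`, `ConstantCurvature.lean`): the orthonormal-frame
  components follow from the pair values by the `ε = 0` case of the Berger–Karcher estimate
  `abs_curvatureForm_frame_sub_le` (`SectionalPinchingEstimate.lean`), and the identity extends to
  all vectors by `4`-linearity;
* `hasConstantSectionalCurvature_of_ricci_eq_three` — the same for EVERY Levi-Civita connection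
  of `g` (`HasConstantSectionalCurvature (λ/2)`, via `IsLeviCivita.curvature_eq_riemann`);
* `scalarCurvature_eq_three_mul_of_ricci_eq` — `S = 3λ`.

## References

* J. M. Lee, *Introduction to Riemannian Manifolds*, 2nd ed. (2018), Prop. 8.32 (Ricci and
  scalar curvature as sums of sectional curvatures), Prop. 8.36 (constant sectional curvature `c`
  iff `Rm = c (g(Y,Z)g(X,W) - g(X,Z)g(Y,W))`), Problem 8-14 (a Riemannian `3`-manifold is Einstein
  iff it has constant sectional curvature). [Lee2018]
* B. O'Neill, *Semi-Riemannian Geometry* (1983), Ch. 3, Prop. 3.36 (curvature symmetries),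
  Lemma 3.52 (Ricci tensor in a frame). [ONeill1983]
-/

noncomputable section

open Bundle Module
open scoped Manifold ContDiff Topology

namespace Literature.Geometry.Riemannian

open Literature.Geometry.Lorentzian (PseudoRiemannianMetric)
open Literature.Geometry.Lorentzian.PseudoRiemannianMetric

variable {E : Type*} [NormedAddCommGroup E] [NormedSpace ℝ E] {H : Type*} [TopologicalSpace H]
  {I : ModelWithCorners ℝ E H} {M : Type*} [TopologicalSpace M] [ChartedSpace H M]
  [IsManifold I ∞ M] {n : ℕ∞ω}

variable (g : PseudoRiemannianMetric I n E (TangentSpace I : M → Type _))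

/-! ### A linear functional vanishing on a basis vanishes -/

omit [IsManifold I ∞ M] in
/-- A function `φ : V → ℝ` which is additive and homogeneous and vanishes on a basis vanishes
identically (the basis expansion; used below one slot at a time). [folklore] -/
private theorem eq_zero_of_forall_basis' {V : Type*} [AddCommGroup V] [Module ℝ V] {ι : Type*}
    (b : Basis ι ℝ V) {φ : V → ℝ} (hadd : ∀ v w, φ (v + w) = φ v + φ w)
    (hsmul : ∀ (a : ℝ) (v : V), φ (a • v) = a * φ v) (hb : ∀ i, φ (b i) = 0) (v : V) :
    φ v = 0 := by
  let L : V →ₗ[ℝ] ℝ :=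
    { toFun := φ
      map_add' := hadd
      map_smul' := fun a v ↦ by rw [hsmul, smul_eq_mul, RingHom.id_apply] }
  have hL : L = 0 := b.ext fun i ↦ by simpa [L] using hb i
  simpa [L] using LinearMap.congr_fun hL v

/-! ### Extending an orthonormal pair to an orthonormal basis in dimension `3` -/

/-- **An orthonormal pair extends to an orthonormal basis** of a `3`-dimensional positive definite
tangent space: if `g_x` is positive definite, `dim E = 3` and `X, Y` are `g_x`-orthonormal, there
is a basis `b = (X, Y, Z)` of `T_x M` which is a `g_x`-orthonormal frame (a unit vector in the
kernel of `v ↦ (g(X,v), g(Y,v))`, which has dimension `≥ 3 - 2 = 1`; O'Neill 1983, Ch. 2,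
Lemma 24 ff.: orthonormal sets extend to orthonormal bases). [cite: ONeill1983, Ch. 2, Lemma 24 (p. 50)] -/
theorem exists_basis_fin_three_extends [FiniteDimensional ℝ E] {x : M}
    (hpos : ∀ v : TangentSpace I x, v ≠ 0 → 0 < g.val x v v) (h3 : finrank ℝ E = 3)
    {X Y : TangentSpace I x} (hX : g.val x X X = 1) (hY : g.val x Y Y = 1)
    (hXY : g.val x X Y = 0) :
    ∃ b : Basis (Fin 3) ℝ (TangentSpace I x), b 0 = X ∧ b 1 = Y ∧ g.IsOrthonormalFrame x b := by
  classical
  haveI : FiniteDimensional ℝ (TangentSpace I x) := ‹FiniteDimensional ℝ E›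
  -- a nonzero vector `z` orthogonal to `X` and `Y` (rank–nullity)
  let f : TangentSpace I x →ₗ[ℝ] ℝ × ℝ :=
    (g.val x X : TangentSpace I x →ₗ[ℝ] ℝ).prod (g.val x Y : TangentSpace I x →ₗ[ℝ] ℝ)
  have hker : 0 < finrank ℝ (LinearMap.ker f) := by
    have h1 := LinearMap.finrank_range_add_finrank_ker f
    have h2 : finrank ℝ (LinearMap.range f) ≤ 2 := by
      calc finrank ℝ (LinearMap.range f) ≤ finrank ℝ (ℝ × ℝ) := Submodule.finrank_le _
        _ = 2 := by rw [Module.finrank_prod, Module.finrank_self]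
    have h3' : finrank ℝ (TangentSpace I x) = 3 := h3
    omega
  obtain ⟨⟨z, hzk⟩, hz0⟩ := Module.finrank_pos_iff_exists_ne_zero.1 hker
  have hz0' : z ≠ 0 := by
    rintro rfl
    exact hz0 (Subtype.ext rfl)
  have hfz : f z = 0 := LinearMap.mem_ker.1 hzk
  have hXz : g.val x X z = 0 := by
    have := congrArg Prod.fst hfz
    simpa [f] using this
  have hYz : g.val x Y z = 0 := by
    have := congrArg Prod.snd hfz
    simpa [f] using this
  -- normalise it
  have hzz : 0 < g.val x z z := hpos z hz0'
  obtain ⟨c, hc⟩ : ∃ c : ℝ, c = (Real.sqrt (g.val x z z))⁻¹ := ⟨_, rfl⟩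
  obtain ⟨Z, hZdef⟩ : ∃ Z : TangentSpace I x, Z = c • z := ⟨_, rfl⟩
  have hZ : g.val x Z Z = 1 := by
    rw [hZdef]
    simp only [map_smul, smul_apply, smul_eq_mul]
    calc c * (c * g.val x z z) = c * c * g.val x z z := by ring
      _ = 1 := by rw [hc, ← mul_inv, Real.mul_self_sqrt hzz.le, inv_mul_cancel₀ hzz.ne']
  have hXZ : g.val x X Z = 0 := by rw [hZdef, map_smul, smul_eq_mul, hXz, mul_zero]
  have hYZ : g.val x Y Z = 0 := by rw [hZdef, map_smul, smul_eq_mul, hYz, mul_zero]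
  have hYX : g.val x Y X = 0 := by rw [g.symm x Y X, hXY]
  have hZX : g.val x Z X = 0 := by rw [g.symm x Z X, hXZ]
  have hZY : g.val x Z Y = 0 := by rw [g.symm x Z Y, hYZ]
  -- the frame `(X, Y, Z)`
  obtain ⟨e, he_def⟩ : ∃ e : Fin 3 → TangentSpace I x, e = ![X, Y, Z] := ⟨_, rfl⟩
  have he0 : e 0 = X := by simp [he_def]
  have he1 : e 1 = Y := by simp [he_def]
  have he2 : e 2 = Z := by simp [he_def]
  have he : g.IsOrthonormalFrame x e := by
    refine ⟨fun i ↦ ?_, fun i j hij ↦ ?_⟩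
    · fin_cases i
      · simpa [he0] using hX
      · simpa [he1] using hY
      · simpa [he2] using hZ
    · fin_cases i <;> fin_cases j
      all_goals (first | exact absurd rfl hij | simp [he0, he1, he2, hXY, hYX, hXZ, hZX, hYZ, hZY])
  have hli : LinearIndependent ℝ e :=
    LinearMap.BilinForm.linearIndependent_of_iIsOrtho (B := g.toBilinForm x)
      (LinearMap.BilinForm.iIsOrtho_def.2 fun i j hij ↦ by simpa using he.2 i j hij)
      fun i ↦ by simp [he.1 i]
  have hcard : Fintype.card (Fin 3) = finrank ℝ (TangentSpace I x) := by
    rw [Fintype.card_fin]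
    exact h3.symm
  refine ⟨basisOfLinearIndependentOfCardEqFinrank hli hcard, ?_, ?_, ?_⟩
  · rw [coe_basisOfLinearIndependentOfCardEqFinrank, he0]
  · rw [coe_basisOfLinearIndependentOfCardEqFinrank, he1]
  · rw [coe_basisOfLinearIndependentOfCardEqFinrank]
    exact he

/-! ### Sectional curvature from the Ricci tensor in dimension `3` -/

variable [FiniteDimensional ℝ E] [CompleteSpace E]
  {cov : CovariantDerivative I E (TangentSpace I : M → Type _)}

/-- **The Ricci tensor determines the sectional curvatures in dimension `3`.** For a Levi-Civita
connection `cov` of the `C^n` metric `g` (`n ≥ 2`) and a `g_x`-orthonormal basis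
`b = (b₀, b₁, b₂)` of `T_x M`:
`2 Rm(b₀, b₁, b₁, b₀) = Ric(b₀, b₀) + Ric(b₁, b₁) - Ric(b₂, b₂)`. Indeed
`Ric(b_a, b_a) = Σ_m Rm(b_m, b_a, b_a, b_m)` (O'Neill 1983, Lemma 3.52; Lee 2018, Prop. 8.32 (a):
`Rc(v,v)` is the sum of the sectional curvatures of the planes `(v, b_k)`), so
`Ric₀₀ = K₀₁ + K₀₂`, `Ric₁₁ = K₀₁ + K₁₂`, `Ric₂₂ = K₀₂ + K₁₂` by pair symmetry.
[cite: Lee2018, Prop. 8.32] [cite: ONeill1983, Ch. 3, Lemma 3.52 and Prop. 3.36 (4)] -/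
theorem two_mul_curvatureForm_pair_eq_of_fin_three (h : g.IsLeviCivita cov) (hn : 2 ≤ n) {x : M}
    (b : Basis (Fin 3) ℝ (TangentSpace I x)) (hb : g.IsOrthonormalFrame x b) :
    2 * g.curvatureForm cov x (b 0) (b 1) (b 1) (b 0) =
      cov.ricci x (b 0) (b 0) + cov.ricci x (b 1) (b 1) - cov.ricci x (b 2) (b 2) := by
  have h10 : g.curvatureForm cov x (b 1) (b 0) (b 0) (b 1) =
      g.curvatureForm cov x (b 0) (b 1) (b 1) (b 0) :=
    h.val_curvature_pair_symm hn x _ _ _ _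
  have h20 : g.curvatureForm cov x (b 2) (b 0) (b 0) (b 2) =
      g.curvatureForm cov x (b 0) (b 2) (b 2) (b 0) :=
    h.val_curvature_pair_symm hn x _ _ _ _
  have h21 : g.curvatureForm cov x (b 2) (b 1) (b 1) (b 2) =
      g.curvatureForm cov x (b 1) (b 2) (b 2) (b 1) :=
    h.val_curvature_pair_symm hn x _ _ _ _
  simp only [g.ricci_eq_sum_of_isOrthonormalFrame b hb cov, Fin.sum_univ_three,
    curvatureForm_self_left, h10, h20, h21]
  ring

/-- **On an Einstein `3`-manifold every orthonormal pair has sectional curvature `λ/2`**: if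
`Ric_x = λ g_x` for a Levi-Civita connection `cov` of `g` (`C^n`, `n ≥ 2`), `g_x` is positive
definite and `dim E = 3`, then `Rm(X, Y, Y, X) = λ/2` for all `g_x`-orthonormal `X, Y` (extend to
an orthonormal basis `(X, Y, Z)` and use `2K(X,Y) = Ric(X,X) + Ric(Y,Y) - Ric(Z,Z) = λ`;
Lee 2018, Problem 8-14). [cite: Lee2018, Problem 8-14] [cite: Lee2018, Prop. 8.32] -/
theorem curvatureForm_pair_eq_of_ricci_eq_three (h : g.IsLeviCivita cov) (hn : 2 ≤ n) {x : M}
    (hpos : ∀ v : TangentSpace I x, v ≠ 0 → 0 < g.val x v v) (h3 : finrank ℝ E = 3) {lam : ℝ}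
    (hRic : ∀ X Y : TangentSpace I x, cov.ricci x X Y = lam * g.val x X Y)
    {X Y : TangentSpace I x} (hX : g.val x X X = 1) (hY : g.val x Y Y = 1)
    (hXY : g.val x X Y = 0) :
    g.curvatureForm cov x X Y Y X = lam / 2 := by
  obtain ⟨b, hb0, hb1, hb⟩ := exists_basis_fin_three_extends g hpos h3 hX hY hXY
  have key := two_mul_curvatureForm_pair_eq_of_fin_three g h hn b hb
  rw [hRic, hRic, hRic, hb.1 0, hb.1 1, hb.1 2, hb0, hb1] at key
  linarith

/-! ### Einstein gives constant sectional curvature `λ/2` in dimension `3` -/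

/-- **An Einstein metric on a `3`-manifold has constant sectional curvature** (Lee 2018,
Problem 8-14; in dimension `3` the Weyl tensor vanishes and `Rm` is the Kulkarni–Nomizu product of
the Schouten tensor with `g`). Over the tree's vocabulary: `g` Riemannian and `C^n` (`n ≥ 2`) on a
manifold modelled on a `3`-dimensional space, with `Ric = λ g`; then the Levi-Civita connection
`g.leviCivita` has `Rm(X, Y, Z, W) = (λ/2) (g(Y,Z) g(X,W) - g(X,Z) g(Y,W))`
(`HasConstantSectionalCurvatureWith`, Lee 2018, Prop. 8.36). Proof: every orthonormal pair has
`Rm(X,Y,Y,X) = λ/2` (`curvatureForm_pair_eq_of_ricci_eq_three`); the `ε = 0` case of the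
Berger–Karcher estimate `abs_curvatureForm_frame_sub_le` then gives all components on a
`g_x`-orthonormal basis, and both sides are `4`-linear.
[cite: Lee2018, Problem 8-14] [cite: Lee2018, Prop. 8.36] -/
theorem hasConstantSectionalCurvatureWith_of_ricci_eq_three [Fact (1 ≤ n)] [g.HasLeviCivita]
    (hn : 2 ≤ n) (hg : g.IsRiemannian) (h3 : finrank ℝ E = 3) {lam : ℝ}
    (hRic : ∀ (x : M) (X Y : TangentSpace I x), g.ricci x X Y = lam * g.val x X Y) :
    g.HasConstantSectionalCurvatureWith g.leviCivita (lam / 2) := by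
  classical
  have hLC : g.IsLeviCivita g.leviCivita := isLeviCivita_leviCivita_holds
  intro x X Y Z W
  obtain ⟨b, hb⟩ := g.exists_basis_isOrthonormalFrame (hg x) h3
  have hRic' : ∀ X Y : TangentSpace I x, g.leviCivita.ricci x X Y = lam * g.val x X Y := by
    intro X Y
    rw [hLC.ricci_eq_ricci hn x]
    exact hRic x X Y
  -- every orthonormal pair has `K = λ/2`
  have hK : ∀ X Y : TangentSpace I x, g.val x X X = 1 → g.val x Y Y = 1 → g.val x X Y = 0 →
      |g.curvatureForm g.leviCivita x X Y Y X - lam / 2| ≤ 0 := by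
    intro X Y hX hY hXY
    rw [curvatureForm_pair_eq_of_ricci_eq_three g hLC hn (hg x) h3 hRic' hX hY hXY, sub_self,
      abs_zero]
  have hδ : ∀ a c : Fin 3, g.val x (b a) (b c) = if a = c then 1 else 0 := by
    intro a c
    by_cases hac : a = c
    · subst hac; simp [hb.1 a]
    · simp [hac, hb.2 a c hac]
  -- the difference of the two sides, as a function of four vectors
  set F : TangentSpace I x → TangentSpace I x → TangentSpace I x → TangentSpace I x → ℝ :=
    fun X Y Z W ↦ g.curvatureForm g.leviCivita x X Y Z W -
      lam / 2 * (g.val x Y Z * g.val x X W - g.val x X Z * g.val x Y W) with hF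
  suffices hF0 : ∀ X Y Z W, F X Y Z W = 0 by
    have := hF0 X Y Z W
    simp only [hF] at this
    linarith
  -- (A) on the basis: the `ε = 0` Berger–Karcher estimate
  have hA : ∀ i j k l, F (b i) (b j) (b k) (b l) = 0 := by
    intro i j k l
    have hle := abs_curvatureForm_frame_sub_le hLC hn (hg x) le_rfl hK hb i j k l
    rw [mul_zero] at hle
    have h0 := abs_nonpos_iff.1 hle
    simp only [hF, hδ]
    linarith
  -- linearity of `F` in each slot
  have hadd₄ : ∀ X Y Z W W', F X Y Z (W + W') = F X Y Z W + F X Y Z W' := by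
    intro X Y Z W W'; simp only [hF, curvatureForm, map_add]; ring
  have hsmul₄ : ∀ X Y Z (a : ℝ) W, F X Y Z (a • W) = a * F X Y Z W := by
    intro X Y Z a W; simp only [hF, curvatureForm, map_smul, smul_eq_mul]; ring
  have hadd₃ : ∀ X Y Z Z' W, F X Y (Z + Z') W = F X Y Z W + F X Y Z' W := by
    intro X Y Z Z' W
    simp only [hF, curvatureForm, map_add, add_apply]; ring
  have hsmul₃ : ∀ X Y (a : ℝ) Z W, F X Y (a • Z) W = a * F X Y Z W := by
    intro X Y a Z W
    simp only [hF, curvatureForm, map_smul, smul_apply, smul_eq_mul]; ring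
  have hadd₂ : ∀ X Y Y' Z W, F X (Y + Y') Z W = F X Y Z W + F X Y' Z W := by
    intro X Y Y' Z W
    simp only [hF, curvatureForm, map_add, add_apply]; ring
  have hsmul₂ : ∀ X (a : ℝ) Y Z W, F X (a • Y) Z W = a * F X Y Z W := by
    intro X a Y Z W
    simp only [hF, curvatureForm, map_smul, smul_apply, smul_eq_mul]; ring
  have hadd₁ : ∀ X X' Y Z W, F (X + X') Y Z W = F X Y Z W + F X' Y Z W := by
    intro X X' Y Z W
    simp only [hF, curvatureForm, map_add, add_apply]; ring
  have hsmul₁ : ∀ (a : ℝ) X Y Z W, F (a • X) Y Z W = a * F X Y Z W := by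
    intro a X Y Z W
    simp only [hF, curvatureForm, map_smul, smul_apply, smul_eq_mul]; ring
  -- (B)–(E): extend from the basis, one slot at a time
  have hB : ∀ i j k W, F (b i) (b j) (b k) W = 0 := fun i j k ↦
    eq_zero_of_forall_basis' b (hadd₄ _ _ _) (hsmul₄ _ _ _) (hA i j k)
  have hC : ∀ i j Z W, F (b i) (b j) Z W = 0 := fun i j Z W ↦
    eq_zero_of_forall_basis' b (φ := fun Z ↦ F (b i) (b j) Z W) (fun Z Z' ↦ hadd₃ _ _ Z Z' W)
      (fun a Z ↦ hsmul₃ _ _ a Z W) (fun k ↦ hB i j k W) Z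
  have hD : ∀ i Y Z W, F (b i) Y Z W = 0 := fun i Y Z W ↦
    eq_zero_of_forall_basis' b (φ := fun Y ↦ F (b i) Y Z W) (fun Y Y' ↦ hadd₂ _ Y Y' Z W)
      (fun a Y ↦ hsmul₂ _ a Y Z W) (fun j ↦ hC i j Z W) Y
  intro X Y Z W
  exact eq_zero_of_forall_basis' b (φ := fun X ↦ F X Y Z W) (fun X X' ↦ hadd₁ X X' Y Z W)
    (fun a X ↦ hsmul₁ a X Y Z W) (fun i ↦ hD i Y Z W) X

/-- **The same for every Levi-Civita connection of `g`** (`HasConstantSectionalCurvature`, the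
`∀ cov, g.IsLeviCivita cov → …` phrasing of `ConstantCurvature.lean`): the curvature tensor of any
torsion-free `g`-compatible connection of a `C^n` metric, `n ≥ 2`, is `g.riemann`
(`IsLeviCivita.curvature_eq_riemann`). [cite: Lee2018, Problem 8-14] [cite: Lee2018, Prop. 8.36] -/
theorem hasConstantSectionalCurvature_of_ricci_eq_three [Fact (1 ≤ n)] [g.HasLeviCivita]
    (hn : 2 ≤ n) (hg : g.IsRiemannian) (h3 : finrank ℝ E = 3) {lam : ℝ}
    (hRic : ∀ (x : M) (X Y : TangentSpace I x), g.ricci x X Y = lam * g.val x X Y) :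
    g.HasConstantSectionalCurvature (lam / 2) := by
  intro cov hcov x X Y Z W
  have h := hasConstantSectionalCurvatureWith_of_ricci_eq_three g hn hg h3 hRic x X Y Z W
  simp only [curvatureForm] at h ⊢
  rw [hcov.curvature_eq_riemann hn x]
  exact h

omit [CompleteSpace E] in
/-- **The scalar curvature of an Einstein `3`-manifold is `3λ`** (`S = tr_g Ric = Σᵢ Ric(bᵢ, bᵢ)`
in a `g_x`-orthonormal basis; Lee 2018, Prop. 8.32 (b)). [cite: Lee2018, Prop. 8.32] -/
theorem scalarCurvature_eq_three_mul_of_ricci_eq [Fact (1 ≤ n)] [g.HasLeviCivita]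
    (hg : g.IsRiemannian) (h3 : finrank ℝ E = 3) {lam : ℝ}
    (hRic : ∀ (x : M) (X Y : TangentSpace I x), g.ricci x X Y = lam * g.val x X Y) (x : M) :
    g.scalarCurvature x = 3 * lam := by
  obtain ⟨b, hb⟩ := g.exists_basis_isOrthonormalFrame (hg x) h3
  rw [scalarCurvature, g.trace_eq_sum_of_isOrthonormalFrame b hb]
  simp only [hRic, hb.1, mul_one, Finset.sum_const, Finset.card_univ, Fintype.card_fin,
    nsmul_eq_mul]
  norm_num

end Literature.Geometry.Riemannian

end
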